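import Summits.HodgeConjecture.HodgeConjecture.Theorems.AffinePartDecayAssembly

/-!
# Route AffinePartDecay — `TargetSuffices` (support item stmt-HodgeConjecture-1970)

`AffineComplementPrinciple → HodgeConjecture`: the target specialised to the middle degree of
even-dimensional varieties is the crux `AffineMiddleDegree`, which gives divisor support of
middle-degree Hodge classes (`affinePartDecay_middleDivisorSupport_of_affineMiddleDegree`: take the
complement of a non-empty affine open) and hence the Hodge conjecture by the tree's dimension
induction `limitExtension_middleDivisorSupportSuffices_proof` (Hodge models by
`nonempty_hodgeModel_holds`).  No named-fact hypothesis, no sorry.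
-/

-- `Summit.HodgeConjecture.HodgeConjecture.Theorems` is the mandated namespace (single-problem
-- summit: Problem = Summit), which `linter.dupNamespace` flags on every declaration; the lakefile
-- turns the linter off tree-wide (weak option), restated here so stand-alone elaboration is
-- warning-free too.
set_option linter.dupNamespace false

noncomputable section

namespace Summit.HodgeConjecture.HodgeConjecture.Theorems

open Literature.AlgebraicGeometry.HodgeTheory

/-- The target `AffineComplementPrinciple` contains the crux `AffineMiddleDegree` (its case
`n = 2m`, `p = m`). [cite: Deligne2000, §1] -/
theorem affinePartDecay_affineMiddleDegree_of_affineComplementPrinciple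
    (h : Summit.HodgeConjecture.HodgeConjecture.Theses.AffinePartDecay.AffineComplementPrinciple) :
    Summit.HodgeConjecture.HodgeConjecture.Theses.AffinePartDecay.AffineMiddleDegree :=
  fun m _X hX H hH hU c hc hpp ↦ h hX H hH hU m c hc hpp

/-- **Item stmt-HodgeConjecture-1970 (`TargetSuffices`), route `AffinePartDecay`**:
`AffineComplementPrinciple → HodgeConjecture` — middle degree ⟹ divisor support of middle-degree
Hodge classes ⟹ the Hodge conjecture (`limitExtension_middleDivisorSupportSuffices_proof` with
`nonempty_hodgeModel_holds`). [cite: Thomas2005Nodes, §2 Prop. 2]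
[cite: DeligneHodgeIII1974, Prop. 8.2.7 and Cor. 8.2.8] -/
theorem affinePartDecay_targetSuffices_proof :
    Summit.HodgeConjecture.HodgeConjecture.Theses.AffinePartDecay.TargetSuffices :=
  fun h ↦ limitExtension_middleDivisorSupportSuffices_proof
    (fun _ _ hX ↦ nonempty_hodgeModel_holds hX)
    (affinePartDecay_middleDivisorSupport_of_affineMiddleDegree
      (affinePartDecay_affineMiddleDegree_of_affineComplementPrinciple h))

end Summit.HodgeConjecture.HodgeConjecture.Theorems

end
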